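import Literature.Barriers.CriticalPhenomena.GaussianDominationRouteDiagramsProofs
import Literature.Barriers.CriticalPhenomena.GaussianDominationRouteLaceExpansionPivotal
import Literature.Probability.FitznerVanDerHofstad2017.NobleLastSausageOffA
import HarnessLib

/-!
# [FvdH17] §4.4 / §6.1: the choice of `(t, z)` in the last level — the CODING LEMMA behind the
# cross-level disjointness clause ("all paths involved are bond disjoint, even when they occur in
# different levels"), PROVED

Source: R. Fitzner, R. van der Hofstad, *Mean-field behavior for nearest-neighbor percolation in
`d > 10`*, Electron. J. Probab. **22** (2017) no. 43 [FvdH17]; arXiv:1506.07977v2.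

* §4.4, the paragraph after (4.65) (arXiv v2 p. 43 = EJP p. 40–41; TeX source l.9113–9118):
  "If we would at this point follow the classical lace expansion, then we would apply the
  BK-inequality on (4.65) … For our bounds, we use one additional property of the diagram that we
  now explain. Recall the definition of repulsive diagrams in Section 4.2. In most cases, we can
  choose `z_i` such that there exists a path from `w_{i-1}` to `z_i` in `C̃_{i-1}` that intersects
  `C̃_i` only at its endpoint `z_i`. We can bound such events using repulsive diagrams. … In this
  case, all paths involved in the above connections are bond disjoint, even when they occur in
  different levels."
* §6.1, caption of Fig. 12 (arXiv v2 p. 58; TeX l.9854): "As explained in Section 4.4 we choose `z`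
  such that the connection `{w ↔ z}` intersects with `C̃₁` only at `z`, so that all connections are
  bond-disjoint."; and l.9894: "when `x = z`, we have the freedom to choose `t = x`".

What this module proves (deterministic graph combinatorics; `A` plays the role of the previous
level's cluster `C̃₀`, `ω` the current level's configuration, `E'(v, x; A)` = `laceE A v x`):

* `exists_lastPivot` — the START OF THE LAST SAUSAGE chosen through an `A`-free route: for
  `ω ∈ E'(v,x;A)` there are `t` and an open walk `W₁ : v → t` whose vertices other than `t` lie
  OUTSIDE `A`, such that no single bond separates `t` from `x`, and every open `t`–`x` path meets
  `W₁` only at `t`.  (`t` is the far end of the last pivotal bond `(a,t)` for `v → x` on an open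
  `v`–`x` path — the `E'` clause "no pivotal bond `(a,·)` with `v ↔ a` THROUGH `A`" supplies an
  `A`-free open route `v → a` — or `t = v` if there is no pivotal bond.)
* `exists_laceCoding` — the CODING: `t`, `z ∈ A` and four pairwise edge-disjoint open walks
  `W₁ : v → t`, `W₂ : t → z`, `W₃ : t → x`, `W₄ : z → x` (so `ω ∈ {v↔t}∘{t↔z}∘{t↔x}∘{z↔x}` as in
  the tree's `laceE_subset_theta`) WITH the two clauses the printed argument uses and the typed
  (4.65) forgets: (i) `W₁` meets `A` at most in `t` and `W₂` meets `A` only in `z` (`z` := the FIRST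
  `A`-vertex on one of two edge-disjoint `t`–`x` paths), hence no bond of `W₁` or `W₂` has both
  endpoints in `A` (`LaceCoding.disjoint_of_forall_mem`) — bond-disjointness from every witness
  living inside `A`, i.e. from every previous-level witness; (ii) the canonical choice
  `z = x → t = x` (l.9894), and conversely `t = x → z = x` (`exists_laceCoding_canonical`: when the
  last sausage is the single point `x`, the first `A`-vertex on it is `x`) — the typed block tables
  of §6.1 / App. B vanish on both off-diagonal families `z = x ≠ t`, `t = x ≠ z`;
* `LaceCoding.mem_eventFNoff`, `exists_mem_eventFNoff_canonical` — the bridge to the event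
  `F_N^{off}` of `NobleLastSausageOffA` ((4.58) with the off-`A` clause): the same union bound, now
  restricted to the canonical pairs `(t, z)`.

These are the level-`1` input of the joint-event form of (4.65) at `N = 1` (LEMMAS §25, carver-g20
ADDENDUM 6, node X1-j1).  Nothing in this module is a cited hypothesis; everything is kernel-proved
for an arbitrary configuration `ω ⊆` bonds of `ℤ^d`.

## References
* [FvdH17] arXiv:1506.07977v2 §4.4 p. 43 (after (4.65)), §6.1 Fig. 12 p. 58, l.9894; EJP 22 (2017) no. 43.
* [HvdH17] M. Heydenreich, R. van der Hofstad, *Progress in high-dimensional percolation and random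
  graphs*, Springer 2017, Def. 6.2–6.3, (6.2.11) (the events `E'`, pivotal bonds, `C̃`).
-/

namespace Literature.Probability.FitznerVanDerHofstad2017

open Literature.Barriers.CriticalPhenomena Literature.Probability.Percolation
open Literature.Probability.LatticeModels Literature.Combinatorics.SimpleGraph _root_.SimpleGraph

variable {d : ℕ}

/-! ### A. Two walk lemmas -/

section Walks

variable {V : Type*} {G : _root_.SimpleGraph V}

/-- In a path `R = q ++ r` split at a vertex `y ≠` its start `t`, the start does not reappear on the
second piece. [folklore] -/
theorem start_notMem_support_of_path_append {t x y : V} {R : G.Walk t x} (hR : R.IsPath)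
    (q : G.Walk t y) (r : G.Walk y x) (h : R = q.append r) (hy : y ≠ t) : t ∉ r.support := by
  intro ht
  have hnd := hR.support_nodup
  rw [h, Walk.support_append] at hnd
  have hdis := List.disjoint_of_nodup_append hnd
  rw [Walk.mem_support_iff] at ht
  rcases ht with ht | ht
  · exact hy ht.symm
  · exact hdis q.start_mem_support ht

/-- In a path `s = q ++ r` (junction `y`), an edge of `q` has no endpoint on `r` other than `y`; in
particular the final vertex of `s` is not an endpoint of an edge of `q` unless it is `y`. [folklore] -/
theorem notMem_edges_of_path_append {v a y b : V} {s : G.Walk v a} (hs : s.IsPath)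
    (q : G.Walk v y) (r : G.Walk y a) (h : s = q.append r) (hb : b ∈ r.support) (hby : b ≠ y)
    (c : V) : s(c, b) ∉ q.edges := by
  intro he
  rw [h] at hs
  obtain ⟨-, -, hmeet⟩ := LaceGraph.isPath_of_append hs
  exact hby (hmeet b (q.snd_mem_support_of_mem_edges he) hb)

end Walks

/-! ### B. The start of the last sausage through an `A`-free route -/

/-- **The last pivotal bond, reached outside `A`.** For `ω ∈ E'(v, x; A)` (bonds of `ℤ^d`) there are
a vertex `t` and an open walk `W₁ : v → t` such that (a) every vertex of `W₁` in `A` equals `t`;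
(b) no bond separates `t` from `x` (`t ⇒ x`: the last sausage); (c) every open `t`–`x` PATH meets
`W₁` only at `t`.  Construction: `t` = far end of the last pivotal bond on an open `v`–`x` path (or
`v`), `W₁` = an `A`-free open route to its near end (clause "no pivotal `(a,·)` with `v ↔ a` through
`A`" of `E'`) followed by the bond. [cite: FitznerVanDerHofstad2017, §4.4 after (4.65) (arXiv:1506.07977v2 p. 43; EJP 22 (2017) no. 43 pp. 40–41)] [cite: HeydenreichVanDerHofstad2017, (6.2.11) and Def. 6.3(c)] -/
theorem exists_lastPivot {ω : BondConfig (Site d)} (hω : ω ⊆ (zdGraph d).edgeSet)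
    {A : Set (Site d)} {v x : Site d} (hE : ω ∈ laceE A v x) :
    ∃ (t : Site d) (W₁ : (openGraph ω).Walk v t),
      (∀ y ∈ W₁.support, y ∈ A → y = t) ∧
      (∀ e : Sym2 (Site d), (openGraph (ω \ {e})).Reachable t x) ∧
      (∀ R : (openGraph ω).Walk t x, R.IsPath → ∀ y ∈ R.support, y ∈ W₁.support → y = t) := by
  classical
  obtain ⟨⟨hvx, hnot⟩, hpiv⟩ := (mem_laceE_iff A v x ω).1 hE
  obtain ⟨p, hp⟩ := (show (openGraph ω).Reachable v x from hvx).exists_isPath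
  -- `L` = `v` together with the far ends of the pivotal bonds for `v → x`
  set L : Set (Site d) := {y | y = v ∨ ∃ a, IsPivotalBond ω v x a y} with hL
  obtain ⟨t, p₁, p₂, hp12, htL, hlast⟩ :=
    exists_append_last_mem L p ⟨v, p.start_mem_support, Or.inl rfl⟩
  rw [hp12] at hp
  obtain ⟨-, hp₂, -⟩ := LaceGraph.isPath_of_append hp
  -- (b) on `p₂`: a separating bond of `p₂` would be a pivotal bond beyond `t`
  have hA : ∀ e ∈ p₂.edges, (openGraph (ω \ {e})).Reachable t x := by
    intro e he
    by_contra htx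
    obtain ⟨a, b, q₁, hab, q₂, rfl, hq⟩ := LaceGraph.exists_append_cons_of_mem_edges p₂ he
    have hnd := hp.isTrail.edges_nodup
    rw [Walk.edges_append] at hnd
    have he1 : s(a, b) ∉ p₁.edges := fun h1 => List.disjoint_of_nodup_append hnd h1 he
    have hvx' : ¬ (openGraph (ω \ {s(a, b)})).Reachable v x := fun h =>
      htx ((reachable_sdiff_of_walk p₁ he1).symm.trans h)
    have hpath' : ((p₁.append q₁).append (Walk.cons hab q₂)).IsPath := by
      rw [← Walk.append_assoc, ← hq]; exact hp
    have hP := isPivotalBond_of_not_reachable hω (p₁.append q₁) hab q₂ hpath' hvx'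
    have hb2 : b ∈ p₂.support := by
      rw [hq, Walk.mem_support_append_iff, Walk.support_cons]
      exact Or.inr (List.mem_cons_of_mem _ q₂.start_mem_support)
    have hbt : b = t := hlast b hb2 (Or.inr ⟨a, hP⟩)
    rw [hq] at hp₂
    have hsn := hp₂.support_nodup
    rw [Walk.support_append, Walk.support_cons, List.tail_cons] at hsn
    have ht2 : t ∈ q₂.support := hbt ▸ q₂.start_mem_support
    exact List.disjoint_of_nodup_append hsn q₁.start_mem_support ht2
  have hcut : ∀ e : Sym2 (Site d), (openGraph (ω \ {e})).Reachable t x := fun e => by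
    by_cases he : e ∈ p₂.edges
    · exact hA e he
    · exact reachable_sdiff_of_walk p₂ he
  rcases htL with htv | ⟨a, hP⟩
  · -- no pivotal bond was met: `t = v`, `W₁` trivial
    subst htv
    refine ⟨t, Walk.nil, fun y hy _ => by simpa using hy, hcut, fun R _ y _ hy1 => by simpa using hy1⟩
  · -- `(a, t)` pivotal for `v → x`: an `A`-free open route `v → a`, then the bond
    have hva : ω ∉ connThrough A v a := hpiv a t hP
    rw [mem_connThrough_iff, not_and, not_not] at hva
    have hreach : ω ∈ openConn v a := reachable_of_mem_restrCluster hP.2.1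
    obtain ⟨s₀, hs₀⟩ := exists_walk_of_openConnIn (hva hreach)
    set s₁ := s₀.bypass with hs₁def
    have hs₁A : ∀ y ∈ s₁.support, y ∉ A := fun y hy => hs₀ y (s₀.support_bypass_subset_support hy)
    have hs₁p : s₁.IsPath := s₀.bypass_isPath
    have hat : (openGraph ω).Adj a t :=
      (openGraph_adj ω a t).2 ⟨mem_of_isPivotalBond hvx hP, hP.1.ne⟩
    have hx : ¬ (openGraph (ω \ {s(a, t)})).Reachable v x := fun h =>
      hP.notMem_target ((mem_restrCluster_iff a t v x ω).2 h)
    -- the `A`-free route avoids the pivotal bond itself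
    have hs₁e : s(a, t) ∉ s₁.edges := by
      intro he
      have ht1 : t ∈ s₁.support := s₁.snd_mem_support_of_mem_edges he
      obtain ⟨q, r, hqr⟩ := Walk.mem_support_iff_exists_append.1 ht1
      have hq : s(a, t) ∉ q.edges := by
        intro heq
        have ha : a ∈ q.support := q.fst_mem_support_of_mem_edges heq
        rw [hqr] at hs₁p
        obtain ⟨-, -, hmeet⟩ := LaceGraph.isPath_of_append hs₁p
        exact hat.ne (hmeet a ha r.end_mem_support)
      exact hx ((reachable_sdiff_of_walk q hq).trans (hcut _))
    let W₁ : (openGraph ω).Walk v t := s₁.append (Walk.cons hat Walk.nil)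
    have hW₁s : ∀ y ∈ W₁.support, y ∈ s₁.support ∨ y = t := by
      intro y hy
      rw [Walk.mem_support_append_iff, Walk.support_cons, Walk.support_nil, List.mem_cons,
        List.mem_singleton] at hy
      rcases hy with hy | rfl | rfl
      · exact Or.inl hy
      · exact Or.inl s₁.end_mem_support
      · exact Or.inr rfl
    refine ⟨t, W₁, fun y hy hyA => ?_, hcut, fun R hR y hyR hyW => ?_⟩
    · rcases hW₁s y hy with hy | hy
      · exact absurd hyA (hs₁A y hy)
      · exact hy
    · by_contra hyt
      have hy1 : y ∈ s₁.support := (hW₁s y hyW).resolve_right hyt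
      obtain ⟨q, r, hqr⟩ := Walk.mem_support_iff_exists_append.1 hy1
      obtain ⟨q', r', hqr'⟩ := Walk.mem_support_iff_exists_append.1 hyR
      have hq : s(a, t) ∉ q.edges := fun h => hs₁e (by
        rw [hqr, Walk.edges_append]; exact List.mem_append_left _ h)
      have hr' : s(a, t) ∉ r'.edges := fun h =>
        start_notMem_support_of_path_append hR q' r' hqr' hyt (r'.snd_mem_support_of_mem_edges h)
      have hwalk : s(a, t) ∉ (q.append r').edges := by
        rw [Walk.edges_append, List.mem_append, not_or]; exact ⟨hq, hr'⟩
      exact hx (reachable_sdiff_of_walk (q.append r') hwalk)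

/-! ### C. The coding of the last level -/

/-- The CODING of a configuration in `E'(v, x; A)`: four pairwise edge-disjoint open walks realising
`{v ↔ t} ∘ {t ↔ z} ∘ {t ↔ x} ∘ {z ↔ x}` with `z ∈ A`, the walks `v → t` and `t → z` meeting `A` only
at their endpoints `t` resp. `z`, and the canonical choice `z = x → t = x`.
[cite: FitznerVanDerHofstad2017, §4.4 after (4.65) and §6.1 Fig. 12 (arXiv:1506.07977v2 pp. 43, 58)] -/
structure LaceCoding (ω : BondConfig (Site d)) (A : Set (Site d)) (v x t z : Site d) where
  /-- the route to the start of the last sausage (`{v ↔ t}`, in print `{b̄ ↔ t}`) -/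
  W₁ : (openGraph ω).Walk v t
  /-- from the start of the last sausage to the first `A`-vertex (`{t ↔ z}`) -/
  W₂ : (openGraph ω).Walk t z
  /-- the second route of the last sausage (`{t ↔ x}`) -/
  W₃ : (openGraph ω).Walk t x
  /-- the rest of the first route (`{z ↔ x}`) -/
  W₄ : (openGraph ω).Walk z x
  d₁₂ : List.Disjoint W₁.edges W₂.edges
  d₁₃ : List.Disjoint W₁.edges W₃.edges
  d₁₄ : List.Disjoint W₁.edges W₄.edges
  d₂₃ : List.Disjoint W₂.edges W₃.edges
  d₂₄ : List.Disjoint W₂.edges W₄.edges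
  d₃₄ : List.Disjoint W₃.edges W₄.edges
  /-- `z ∈ A` ("the last sausage is where `A` is hit") -/
  mem : z ∈ A
  /-- `W₁` meets `A` at most in `t` -/
  free₁ : ∀ y ∈ W₁.support, y ∈ A → y = t
  /-- `W₂` meets `A` only in `z` -/
  free₂ : ∀ y ∈ W₂.support, y ∈ A → y = z
  /-- the canonical choice "when `x = z` we choose `t = x`" -/
  canon : z = x → t = x

namespace LaceCoding

variable {ω : BondConfig (Site d)} {A : Set (Site d)} {v x t z : Site d}

/-- The four coded connections occur disjointly (the tree's (4.63)-shape event).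
[cite: FitznerVanDerHofstad2017, (4.58) and (4.63) (arXiv:1506.07977v2 pp. 41–42)] -/
theorem mem_disjointOccurrenceList (c : LaceCoding ω A v x t z) :
    ω ∈ disjointOccurrenceList
      [openConn v t, openConn t z, openConn t x, (openConn z x : Set (BondConfig (Site d)))] :=
  mem_disjointOccurrenceList_of_walks c.W₁ c.W₂ c.W₃ c.W₄ c.d₁₂ c.d₁₃ c.d₁₄ c.d₂₃ c.d₂₄ c.d₃₄

/-- If `z ≠ t` then `t ∉ A`. [cite: FitznerVanDerHofstad2017, §6.1 Fig. 12 (arXiv:1506.07977v2 p. 58)] -/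
theorem start_notMem (c : LaceCoding ω A v x t z) (hzt : z ≠ t) : t ∉ A :=
  fun ht => hzt (c.free₂ t c.W₂.start_mem_support ht).symm

/-- **The cross-level clause.** No bond of `W₁` or of `W₂` has both endpoints in `A`; hence the bonds
of `W₁` and `W₂` are disjoint from any bond set all of whose bonds join two vertices of `A` — such
as every witness of a previous-level connection inside `A = C̃₀`: "all paths involved in the above
connections are bond disjoint, even when they occur in different levels".
[cite: FitznerVanDerHofstad2017, §4.4 after (4.65) (arXiv:1506.07977v2 p. 43)] -/
theorem disjoint_of_forall_mem (c : LaceCoding ω A v x t z) {K : Set (Sym2 (Site d))}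
    (hK : ∀ e ∈ K, ∀ y ∈ e, y ∈ A) :
    Disjoint {e | e ∈ c.W₁.edges} K ∧ Disjoint {e | e ∈ c.W₂.edges} K := by
  have key : ∀ {u w : Site d} (W : (openGraph ω).Walk u w) (b : Site d),
      (∀ y ∈ W.support, y ∈ A → y = b) → Disjoint {e | e ∈ W.edges} K := by
    intro u w W b hW
    refine Set.disjoint_left.2 fun e he heK => ?_
    induction e using Sym2.ind with
    | h y₁ y₂ =>
      have hy₁ := hW y₁ (W.fst_mem_support_of_mem_edges he) (hK _ heK y₁ (Sym2.mem_mk_left _ _))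
      have hy₂ := hW y₂ (W.snd_mem_support_of_mem_edges he) (hK _ heK y₂ (Sym2.mem_mk_right _ _))
      exact (W.adj_of_mem_edges he).ne (hy₁.trans hy₂.symm)
  exact ⟨key c.W₁ t c.free₁, key c.W₂ z c.free₂⟩

/-- The class-`1` bond `(t, z)` of the last level (when `z ≠ t`) has the endpoint `t ∉ A`, so it is not a
bond between two vertices of `A` either. [cite: FitznerVanDerHofstad2017, §6.1 case `b = 1` (arXiv:1506.07977v2 p. 59)] -/
theorem bond_notMem_of_forall_mem (c : LaceCoding ω A v x t z) (hzt : z ≠ t) {K : Set (Sym2 (Site d))}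
    (hK : ∀ e ∈ K, ∀ y ∈ e, y ∈ A) : s(t, z) ∉ K :=
  fun h => c.start_notMem hzt (hK _ h t (Sym2.mem_mk_left _ _))

end LaceCoding

/-- **The coding lemma of the last level.** For a configuration using bonds of `ℤ^d`,
`E'(v, x; A)` is coded by some `(t, z)`: `z ∈ A`, four pairwise edge-disjoint open walks
`v → t → z`, `t → x`, `z → x`, the first two meeting `A` only at their far endpoints, and `t = x`
if and only if `z = x` (canonical pairs).  This is the tree's `laceE_subset_theta` WITH the two clauses of the printed
argument ((i) cross-level bond-disjointness, (ii) the canonical `t`).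
[cite: FitznerVanDerHofstad2017, §4.4 after (4.65) (arXiv:1506.07977v2 p. 43; EJP 22 (2017) no. 43 pp. 40–41) and §6.1 Fig. 12, l.9894 (v2 p. 58)] -/
theorem exists_laceCoding_canonical {ω : BondConfig (Site d)} (hω : ω ⊆ (zdGraph d).edgeSet)
    {A : Set (Site d)} {v x : Site d} (hE : ω ∈ laceE A v x) :
    ∃ t z : Site d, (t = x → z = x) ∧ Nonempty (LaceCoding ω A v x t z) := by
  classical
  obtain ⟨⟨hvx, hnot⟩, -⟩ := (mem_laceE_iff A v x ω).1 hE
  obtain ⟨t, W₁, hW₁A, hcut, hW₁⟩ := exists_lastPivot hω hE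
  -- two edge-disjoint routes of the last sausage
  obtain ⟨p₀, hp₀⟩ := ((hcut s(x, x)).mono (openGraph_mono fun _ h => h.1)).symm.exists_isPath
  obtain ⟨P, Q, hP, hQ, hPQ⟩ := LaceGraph.exists_two_edgeDisjoint_paths p₀ hp₀ fun e _ =>
    exists_walk_of_reachable_sdiff (hcut e)
  -- `P` meets `A` (else `W₁ ++ P` joins `v` to `x` off `A`)
  have hmeet : ∃ y ∈ P.support, y ∈ A := by
    by_contra hcon
    push Not at hcon
    have htA : t ∉ A := hcon t P.start_mem_support
    refine hnot (openConnIn_of_walk (W₁.append P) fun y hy => ?_)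
    rw [Walk.mem_support_append_iff] at hy
    rcases hy with hy | hy
    · exact fun hyA => htA (hW₁A y hy hyA ▸ hyA)
    · exact hcon y hy
  obtain ⟨z, W₂, W₄, hP24, hzA, hfirst⟩ := exists_append_first_mem A P hmeet
  have h1P : List.Disjoint W₁.edges P.edges :=
    LaceGraph.edges_disjoint_of_support P W₁ (hW₁ P hP)
  have h1Q : List.Disjoint W₁.edges Q.edges :=
    LaceGraph.edges_disjoint_of_support Q W₁ (hW₁ Q hQ)
  rw [hP24] at hP hPQ h1P
  have h24 : List.Disjoint W₂.edges W₄.edges := by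
    have hnd := hP.isTrail.edges_nodup
    rw [Walk.edges_append] at hnd
    exact List.disjoint_of_nodup_append hnd
  have hsubP : ∀ {e}, e ∈ W₂.edges ∨ e ∈ W₄.edges → e ∈ (W₂.append W₄).edges := fun h => by
    rw [Walk.edges_append, List.mem_append]; exact h
  by_cases hzx : z = x ∧ t ≠ x
  · -- canonical re-coding: `z = x ≠ t` ⇒ take `t := x`, the route `W₁ ++ P`
    obtain ⟨hzx, htx⟩ := hzx
    subst hzx
    have htA : t ∉ A := fun htA => htx (hfirst t W₂.start_mem_support htA)
    obtain ⟨-, hW₄, -⟩ := LaceGraph.isPath_of_append hP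
    have hW₄nil : W₄ = Walk.nil := Walk.eq_nil_iff_nil.2 (Walk.isPath_iff_nil.1 hW₄)
    refine ⟨z, z, fun _ => rfl, ⟨⟨W₁.append (W₂.append W₄), Walk.nil, Walk.nil, Walk.nil, by simp,
      by simp, by simp, by simp, by simp, by simp, hzA, fun y hy hyA => ?_,
      fun y hy _ => by simpa using hy, fun _ => rfl⟩⟩⟩
    rw [Walk.mem_support_append_iff, Walk.mem_support_append_iff] at hy
    rcases hy with hy | hy | hy
    · exact absurd (hW₁A y hy hyA ▸ hyA) htA
    · exact hfirst y hy hyA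
    · rw [hW₄nil, Walk.support_nil, List.mem_singleton] at hy
      exact hy
  · refine ⟨t, z, fun htx => ?_, ⟨⟨W₁, W₂, Q, W₄, fun e h1 h2 => h1P h1 (hsubP (Or.inl h2)), h1Q,
      fun e h1 h2 => h1P h1 (hsubP (Or.inr h2)), fun e h2 h3 => hPQ (hsubP (Or.inl h2)) h3, h24,
      fun e h3 h4 => hPQ (hsubP (Or.inr h4)) h3, hzA, hW₁A, hfirst, fun h => ?_⟩⟩⟩
    · -- `t = x`: the last sausage is the point `x`, so its first `A`-vertex `z` is `x`
      subst htx
      have hlen := Walk.length_eq_zero_iff.2 (Walk.isPath_iff_nil.1 hP)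
      rw [Walk.length_append] at hlen
      exact (Walk.eq_of_length_eq_zero (p := W₂) (by omega)).symm
    · by_contra htx
      exact hzx ⟨h, htx⟩

/-- The coding lemma without the converse clause (rev 1 statement).
[cite: FitznerVanDerHofstad2017, §4.4 after (4.65) (arXiv:1506.07977v2 p. 43) and §6.1 Fig. 12 (v2 p. 58)] -/
theorem exists_laceCoding {ω : BondConfig (Site d)} (hω : ω ⊆ (zdGraph d).edgeSet)
    {A : Set (Site d)} {v x : Site d} (hE : ω ∈ laceE A v x) :
    ∃ t z : Site d, Nonempty (LaceCoding ω A v x t z) := by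
  obtain ⟨t, z, -, h⟩ := exists_laceCoding_canonical hω hE
  exact ⟨t, z, h⟩

/-- Corollary in the shape of the tree's `laceE_subset_theta`, with the canonical `t` and `z ∈ A`:
`E'(v,x;A) ⊆ ⋃_{z ∈ A} ⋃_{t : z = x → t = x} {v↔t}∘{t↔z}∘{t↔x}∘{z↔x}`.
[cite: FitznerVanDerHofstad2017, (4.63) and §6.1 l.9894 (arXiv:1506.07977v2 pp. 42, 58)] -/
theorem laceE_subset_theta_canonical {ω : BondConfig (Site d)} (hω : ω ⊆ (zdGraph d).edgeSet)
    {A : Set (Site d)} {v x : Site d} (hE : ω ∈ laceE A v x) :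
    ∃ z ∈ A, ∃ t : Site d, (z = x → t = x) ∧ ω ∈ disjointOccurrenceList
      [openConn v t, openConn t z, openConn t x, (openConn z x : Set (BondConfig (Site d)))] := by
  obtain ⟨t, z, ⟨c⟩⟩ := exists_laceCoding hω hE
  exact ⟨z, c.mem, t, c.canon, c.mem_disjointOccurrenceList⟩

/-- Corollary with BOTH canonical clauses:
`E'(v,x;A) ⊆ ⋃_{z ∈ A} ⋃_{t : z = x ↔ t = x} {v↔t}∘{t↔z}∘{t↔x}∘{z↔x}`.
[cite: FitznerVanDerHofstad2017, (4.63) and §6.1 l.9894 (arXiv:1506.07977v2 pp. 42, 58)] -/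
theorem laceE_subset_theta_canonical₂ {ω : BondConfig (Site d)} (hω : ω ⊆ (zdGraph d).edgeSet)
    {A : Set (Site d)} {v x : Site d} (hE : ω ∈ laceE A v x) :
    ∃ z ∈ A, ∃ t : Site d, (z = x ↔ t = x) ∧ ω ∈ disjointOccurrenceList
      [openConn v t, openConn t z, openConn t x, (openConn z x : Set (BondConfig (Site d)))] := by
  obtain ⟨t, z, htx, ⟨c⟩⟩ := exists_laceCoding_canonical hω hE
  exact ⟨z, c.mem, t, ⟨c.canon, htx⟩, c.mem_disjointOccurrenceList⟩

namespace LaceCoding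

variable {ω : BondConfig (Site d)} {A : Set (Site d)} {v x t z : Site d}

/-- **Bridge to `F_N^{off}`** (`NobleLastSausageOffA.eventFNoff`, (4.58) with the off-`A` clause): a coded
configuration with all bonds at `u` vacant (`u ≠ v`) lies in `F_N^{off}((u,v),t,z,x;A)`.
[cite: FitznerVanDerHofstad2017, (4.58), (4.63) and §4.4 after (4.65) (arXiv:1506.07977v2 pp. 41–43)] -/
theorem mem_eventFNoff (c : LaceCoding ω A v x t z) {u : Site d} (huv : u ≠ v) (hvac : ω ∈ eventVac u) :
    ω ∈ eventFNoff A u v t z x := by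
  have hvt : ω ∈ (openConn v t : Set (BondConfig (Site d))) := c.W₁.reachable
  have htz : ω ∈ (openConn t z : Set (BondConfig (Site d))) := c.W₂.reachable
  have htx : ω ∈ (openConn t x : Set (BondConfig (Site d))) := c.W₃.reachable
  have htu : t ≠ u := by
    rintro rfl
    exact huv (eq_of_mem_eventVac_of_mem_openConn hvac hvt).symm
  have hzu : z ≠ u := by
    rintro rfl
    exact htu (eq_of_mem_eventVac_of_mem_openConn hvac htz)
  have hxu : x ≠ u := by
    rintro rfl
    exact htu (eq_of_mem_eventVac_of_mem_openConn hvac htx)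
  refine ⟨⟨{e | e ∈ c.W₁.edges}, {e | e ∈ c.W₂.edges}, {e | e ∈ c.W₃.edges}, {e | e ∈ c.W₄.edges},
    edgesSet_subset_of_walk c.W₁, edgesSet_subset_of_walk c.W₂, edgesSet_subset_of_walk c.W₃,
    edgesSet_subset_of_walk c.W₄, edgesSet_mem_openConn c.W₁, edgesSet_mem_openConn c.W₂,
    edgesSet_mem_openConn c.W₃, edgesSet_mem_openConn c.W₄,
    disjoint_edgesSet_of_disjoint c.W₁ c.W₂ c.d₁₂, disjoint_edgesSet_of_disjoint c.W₁ c.W₃ c.d₁₃,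
    disjoint_edgesSet_of_disjoint c.W₁ c.W₄ c.d₁₄, disjoint_edgesSet_of_disjoint c.W₂ c.W₃ c.d₂₃,
    disjoint_edgesSet_of_disjoint c.W₂ c.W₄ c.d₂₄, disjoint_edgesSet_of_disjoint c.W₃ c.W₄ c.d₃₄, ?_⟩, ?_⟩
  · rintro e (he | he)
    · exact exists_not_mem_of_mem_edges c.W₁ c.free₁ he
    · exact exists_not_mem_of_mem_edges c.W₂ c.free₂ he
  · simp only [Set.mem_setOf_eq, Set.mem_insert_iff, Set.mem_singleton_iff, not_or]
    exact ⟨htu.symm, hzu.symm, hxu.symm⟩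

end LaceCoding

/-- **`E' ⊆ ⋃ F_N^{off}` over the CANONICAL pairs**: in `E'(v,x;A) ∩ E_vac(u)` (`u ≠ v`, lattice
configuration) the event `F_N^{off}((u,v),t,z,x;A)` occurs for some `z ∈ A` and `t` with `z = x ↔ t = x`
— `NobleLastSausageOffA.exists_mem_eventFNoff_of_mem_laceE` restricted to the pairs the block tables see.
[cite: FitznerVanDerHofstad2017, (4.63), §4.4 after (4.65), §6.1 l.9894 (arXiv:1506.07977v2 pp. 42–43, 58)] -/
theorem exists_mem_eventFNoff_canonical {ω : BondConfig (Site d)} (hω : ω ⊆ (zdGraph d).edgeSet)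
    {A : Set (Site d)} {u v x : Site d} (huv : u ≠ v) (hE : ω ∈ laceE A v x) (hvac : ω ∈ eventVac u) :
    ∃ z ∈ A, ∃ t : Site d, (z = x ↔ t = x) ∧ ω ∈ eventFNoff A u v t z x := by
  obtain ⟨t, z, htx, ⟨c⟩⟩ := exists_laceCoding_canonical hω hE
  exact ⟨z, c.mem, t, ⟨c.canon, htx⟩, c.mem_eventFNoff huv hvac⟩

end Literature.Probability.FitznerVanDerHofstad2017
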